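import Summits.SmoothPoincare4.SmoothPoincare4.Theses.WeakReductionDescent
import Literature.Topology.FourManifolds.SphereTrisectionsSectors
import Literature.Topology.FourManifolds.TrisectionFunctorGKNaturality
import Literature.Topology.FourManifolds.HomotopyS4CompactProofs
import Literature.Topology.FourManifolds.HomotopyS4OrientableProofs
import Literature.Topology.FourManifolds.TrisectionEulerProofs

/-!
# Birth attack on crux `WeakReductionDescent.DependentTripleGenusThreeStandard` (X_F = Aranda–Zupan 2025 Thm 1.4 / Cor 1.5 for homotopy spheres) — findings: elaborates (rc 0), SPC4-shielded at every genus (`S → C` proved), `C → S` unavailable, a kill = an exotic S⁴ of trisection genus ≤ 3 carrying a genus-3 trisection with a dependent triple, dropping the geometric hypotheses restates the summit verbatim, type forced to Σ kᵢ = 3, faithful to arXiv:2503.04607 pp. 2, 6, 24–26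

Seat refuter-rattack-stmt-SmoothPoincare4-18000-0, 2026-08-17 (crux attack at birth, gen 1, after the
item's promotion support → crux by planner-rchoice-…-377cd79d).  Route
`route-SmoothPoincare4-WeakReductionDescent` rev 4; item stmt-SmoothPoincare4-18000; the decl is
VERBATIM the vendored named fact
`Literature.Topology.FourManifolds.arandaZupan_dependentTriple_genusThree_homotopySphere`
(`Theorems/WeakReductionDescentDependentTripleGenusThreeStandard.lean`,
`dependentTripleGenusThreeStandard_iff_arandaZupan`, `Iff.rfl`, prover-pitem-18000-0, p156575).

Kernel-checked content (this file is sorry-free):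

* (c) `dependentTripleGenusThreeStandard_iff` — readback through the factored dependent-triple
  clause `DT M T` (`Iff.rfl`); the clause mentions neither `k` nor `e`.
* (a) SHIELD, every rung.  `DependentTripleStandardAt g₀` is the decl with `3` replaced by `g₀`;
  `dependentTripleGenusThreeStandard_iff_at_three` (`Iff.rfl`) and
  `dependentTripleStandardAt_of_spc4 : SmoothPoincare4 → ∀ g₀, DependentTripleStandardAt g₀`:
  the conclusion is an instance of the summit, the trisection and the triple are not used.  So
  neither the item nor any genus-variant of it is refutable short of `¬ SmoothPoincare4`
  (`shield`; the same statement is landed as `Theorems.dependentTripleGenusThreeStandard_of_smoothPoincare`).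
* (b) KILL CRITERION.  `not_spc4_of_not`, `exotic_of_not` — a refutation is a smooth homotopy
  4-sphere `M` with NO diffeomorphism to `S⁴` that carries a genus-3 GK-trisection with a
  dependent triple (hence, by the proved tree theorems, of trisection genus `≤ 3` and `≠ 0`).
* (d) RESTATES-SUMMIT PROBES.  `withoutGeometry_iff_spc4` — the decl with BOTH geometric
  hypotheses (`IsGKTrisection M 3 k T`, dependent triple) dropped is LITERALLY `SmoothPoincare4`
  (`Iff` by unfolding Mathlib's `NonemptyDiffeomorphSphere`): relative to `S` the whole content of
  the item is its geometric hypothesis.  `C → S` is NOT available (`exact?` fails on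
  `DependentTripleGenusThreeStandard → SmoothPoincare4`, seat file `Scratch.lean`): the item is
  silent on homotopy spheres of trisection genus `≥ 4` and on genus-3 trisections without a
  dependent triple.
* (e) THE TYPE.  `sum_k_eq_three` — under the decl's hypotheses `k 0 + k 1 + k 2 = 3`
  UNCONDITIONALLY (proved Euler identity `gkTrisection_genus_eq_sum_of_homotopyEquiv_sphere_holds`
  fed with compactness / orientation of `M ≃ₕ S⁴`, both proved); `type_dichotomy` — hence either
  `k = (1,1,1)` or some `kᵢ ≥ 2 = g − 1`.  This is exactly Aranda–Zupan's standing split (p. 6,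
  after Prop. 2.6 [MSZ16]: "we will henceforth assume that any (3; k₁,k₂,k₃)-trisection appearing
  in this paper will satisfy kᵢ ∈ {0,1}, since these are the unclassified cases"): the decl over
  ALL `k` = printed Thm 1.4 (kᵢ ≤ 1) + MSZ16 Prop. 2.6 / Thm 1.2 (some kᵢ ≥ g − 1 ⇒ connected sum
  of genus-one trisections ⇒ `S⁴` for a homotopy sphere), both in print; the tree records the
  second half as `dependentTripleGenusThreeStandard_of_msz_of_balanced` (Theorems, modulo the
  named fact `msz_homotopySphere_gk`).  Not a misstatement.

Paper / probe findings (not formalisable here; for the prover and the planner):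

* ELABORATION.  `W.lean` (seat folder): `theorem probe : …DependentTripleGenusThreeStandard :=
  by sorry` rc 0, one sorry warning; the body re-typed symbol by symbol is `rfl`-equal to the
  decl.  No coercion traps (no ℕ-subtraction, division, `tsum`, `sSup`); `IsConnected (F ∖ c)`
  demands non-emptiness (fine: genus-3 surface minus a circle); `¬ IsPreconnected` = disconnected;
  quantifier order ∀ M ∀ e ∀ k ∀ T (trisection → triple → conclusion) = the printed corollary
  (conclusion depends on `M` only).  Instances: `ChartedSpace (EuclideanSpace ℝ (Fin 1))` on the
  unit circle of `ℝ²` and `ChartedSpace (EuclideanHalfSpace 2)` on the closed unit disc come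
  from Mathlib / `Literature.Topology.FourManifolds.ClosedBall` (the route's import).
* TRIVIALITY (`Scratch.lean`): `exact?` fails on the decl after `intro`s; `simp_all` and `aesop`
  run out of heartbeats without closing; `exact?` fails on the bare conclusion
  `Nonempty (M ≃ₘ S⁴)` from `e` alone (it is an instance of SPC4) and on `False` from all
  hypotheses (no vacuity visible to the library).
* VACUITY (paper).  Hypotheses are satisfiable at `M = S⁴`: the three-fold stabilisation of the
  Gay–Kirby genus-0 trisection is a `(3;1,1,1)`-trisection of `S⁴` whose diagram is a connected
  sum of three genus-one stabilisation diagrams (`α₁ = β₁`, `β₂ = γ₂`, `γ₃ = α₃` with duals); the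
  triple `(a, b, c) = (α₁, push-off of β₁ = α₁, γ₂)` is pairwise disjoint, non-separating,
  compressing in `H_α, H_β, H_γ` respectively, and `a ∪ b` already separates (annulus) — a
  dependent triple of AZ §7 case (1).  Formal witness out of reach this cycle (needs a genus-3
  `IsGKTrisection` of `S⁴` with explicit smooth circles/discs; the tree has genus 0 only,
  `sphere_genusZero_gkTrisection_holds`).  So the item is not vacuously true for lack of
  instances; under SPC4 every instance has `M ≅ S⁴` (that is the shield, not vacuity).
* FAITHFULNESS (arXiv:2503.04607, held text re-read pp. 2, 6, 24–26).  p. 2 L26–37: dependent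
  triple = "three pairwise disjoint non-separating curves α₁, β₁, γ₁ bounding disks in H_α, H_β,
  H_γ, respectively, such that [α₁], [β₁], [γ₁] are linearly dependent in H₁(Σ)"; Thm 1.4
  "Suppose a genus-three trisection 𝒯 of X admits a dependent triple. Then either 𝒯 is reducible,
  or 𝒯 contains a five-chain. In particular, X is diffeomorphic to a spun lens space S_p or its
  sibling S′_p, S⁴, or a connected sum of copies of ±ℂP², S¹ × S³, and S² × S²"; Cor 1.5 "If X is
  simply-connected and admits a genus-three trisection 𝒯 with a dependent triple, then X is
  diffeomorphic to S⁴ or a connected sum of copies of ±ℂP², and S² × S²" — with `H₂(M) = 0` only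
  `S⁴` remains, as the decl concludes.  (i) Linear dependence vs `¬ IsPreconnected (F ∖ (a∪b∪c))`:
  equivalent for pairwise disjoint simple closed curves on a closed connected orientable surface
  (a component `R ≠ F ∖ C` of the complement has `∂[R̄] = Σ ±[cᵢ]` over the curves one-sidedly
  adjacent to `R`, a non-trivial relation — if every adjacent curve were two-sided `R̄` would be
  clopen; conversely a connected complement gives dual curves `dⱼ · cᵢ = δᵢⱼ`, independence over
  ℤ, ℚ and ℤ/2 alike).  All three configurations of §7 p. 24 (two curves homotopic / homologous
  not homotopic / pants-cobounding) are admitted on both sides.  (ii) The decl's discs are smooth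
  embeddings of the closed disc into `M` with image in `H p`, boundary onto the curve and interior
  off `F`, not required to be neat (transverse to `∂H`): harmless — a curve on `∂H` bounding ANY
  embedded (even singular) disc in the handlebody is null-homotopic in `H`, so by Dehn's lemma it
  bounds a neat compressing disc; AZ's hypothesis follows from the decl's.  (iii) One curve per
  handlebody: `H 0 = T 1 ∩ T 2`, `H 1 = T 0 ∩ T 2`, `H 2 = T 0 ∩ T 1` versus `H_α, H_β, H_γ` — a
  labelling, and the printed hypothesis is symmetric under it.  (iv) `IsGKTrisection` (sectors
  with corners, handle counts) versus AZ's trisections (p. 5, `(g; k₁,k₂,k₃)` allowed): the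
  tree-wide GK-definition correspondence, shared with `LowGenusBase`/`GenusThreeBase`, not
  specific to this item.  (v) p. 6 standing assumption `kᵢ ∈ {0,1}`: see (e) above.
* MUTATION.  Drop `e : M ≃ₕ S⁴` (keep closed, oriented): FALSE in kind — `#³(S¹ × S³)` with its
  `(3;3,3,3)`-trisection (connected sum of three genus-one trisections of `S¹ × S³`,
  `αᵢ = βᵢ = γᵢ`) carries the case-(1) dependent triple `(α₁, β₁-parallel, γ₁-parallel)` and is
  not `S⁴`; likewise the spun lens spaces `S_p`, `p ≥ 2` (AZ Fig. 3: the spin of `ℝP³` has a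
  weakly reducible genus-3 trisection, hence a dependent triple; `π₁ = ℤ/p`).  So the
  homotopy-sphere hypothesis (at least `π₁ = 1 ∧ H₂ = 0`) is load-bearing.  Drop the dependent
  triple (keep the genus-3 trisection): the statement becomes "genus-3-trisected homotopy
  4-spheres are standard" = MSZ16 + the open `(3;1,1,1)` frontier (Meier's Conjecture,
  `LowGenusTrisectionBarrier`'s first open type) — open, SPC4-shielded.  Drop trisection AND
  triple: literally `SmoothPoincare4` ((d)).  Replace `3` by `g₀`: `g₀ ≤ 2` is MSZ16/MZ17
  (`LowGenusBase` grade, in print); `g₀ ≥ 4` has no theorem in print (dependent triples do not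
  classify above genus 3) — open, shielded ((a)).  Strengthen the conclusion to the printed
  dichotomy "𝒯 reducible or contains a five-chain": that is prover-pitem-18000-c1's
  `…DependentTripleGenusThreeStandardDichotomy.lean` (p157943), forms (W)/(D).
* COMPUTE.  Nothing finite to certify: a falsifier is an exotic 4-sphere.
* bc/ probes: none found under `Cruxes/` for this decl (the planner's evidence files
  planner-note-18000.md / REPAIR-PLAN.md / Sketch.lean are ledger evidence, not readable from this
  jail; their notes say: formalisation crux ≡ vendored fact, foreseen 3-child split along §7).
-/

open scoped Manifold ContDiff Topology ContinuousMap
open Set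

namespace Summit.SmoothPoincare4.SmoothPoincare4.Cruxes.DependentTripleGenusThreeStandard.BirthAttack

set_option linter.dupNamespace false

open Literature.Topology.FourManifolds
open Summit.SmoothPoincare4.SmoothPoincare4.Theses.WeakReductionDescent

/-- The round `4`-sphere of Mathlib. -/
local notation "𝕊⁴" => (Metric.sphere (0 : EuclideanSpace ℝ (Fin 5)) 1)

/-! ### (c) The dependent-triple clause, factored, and the readback -/

/-- The `let`-bound dependent-triple hypothesis of the decl, verbatim, as a predicate of the
ambient manifold `M` and the sectors `T` (it mentions neither `k` nor `e`; it is the same clause as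
in the sibling crux `DependentTripleAtThree`). [folklore] -/
def DT (M : Type) [TopologicalSpace M] [ChartedSpace (EuclideanSpace ℝ (Fin 4)) M]
    (T : Fin 3 → Set M) : Prop :=
  (let F : Set M := ⋂ l, T l; let H : Fin 3 → Set M := fun p => ⋂ (l : Fin 3) (_ : l ≠ p), T l; let IsCurve : Set M → Prop := fun c => c ⊆ F ∧ ∃ γ : (Metric.sphere (0 : EuclideanSpace ℝ (Fin 2)) 1) → M, Manifold.IsSmoothEmbedding (𝓡 1) (𝓡 4) ((⊤ : ℕ∞) : WithTop ℕ∞) γ ∧ Set.range γ = c; let BoundsDisc : Set M → Set M → Prop := fun A c => ∃ d : (Metric.closedBall (0 : EuclideanSpace ℝ (Fin 2)) 1) → M, Manifold.IsSmoothEmbedding (𝓡∂ 2) (𝓡 4) ((⊤ : ℕ∞) : WithTop ℕ∞) d ∧ Set.range d ⊆ A ∧ d '' ((𝓡∂ 2).boundary (Metric.closedBall (0 : EuclideanSpace ℝ (Fin 2)) 1)) = c ∧ Set.range d ∩ F = c; let NonSep : Set M → Prop := fun c => IsConnected (F \ c); let DependentTriple : Prop := ∃ (a b c : Set M), IsCurve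 a ∧ IsCurve b ∧ IsCurve c ∧ Disjoint a b ∧ Disjoint b c ∧ Disjoint a c ∧ NonSep a ∧ NonSep b ∧ NonSep c ∧ BoundsDisc (H 0) a ∧ BoundsDisc (H 1) b ∧ BoundsDisc (H 2) c ∧ ¬ IsPreconnected (F \ (a ∪ b ∪ c)); DependentTriple)

/-- The decl with the genus `3` replaced by a parameter `g₀` (everything else verbatim):
"a smooth homotopy 4-sphere with a genus-`g₀` GK-trisection admitting a dependent triple is
diffeomorphic to `S⁴`". [folklore] -/
def DependentTripleStandardAt (g₀ : ℕ) : Prop :=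
  ∀ (M : Type) [TopologicalSpace M] [T2Space M] [SecondCountableTopology M]
    [ChartedSpace (EuclideanSpace ℝ (Fin 4)) M] [IsManifold (𝓡 4) ∞ M],
    (M ≃ₕ 𝕊⁴) → ∀ (k : Fin 3 → ℕ) (T : Fin 3 → Set M),
      IsGKTrisection M g₀ k T → DT M T → Nonempty (M ≃ₘ⟮𝓡 4, 𝓡 4⟯ 𝕊⁴)

/-- **Readback.** The crux, read through the factorisation — `Iff.rfl`, so `DT` IS the decl's
dependent-triple clause and the conclusion IS `Nonempty (M ≃ₘ⟮𝓡 4, 𝓡 4⟯ S⁴)`. [folklore] -/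
theorem dependentTripleGenusThreeStandard_iff :
    DependentTripleGenusThreeStandard ↔
      ∀ (M : Type) [TopologicalSpace M] [T2Space M] [SecondCountableTopology M]
        [ChartedSpace (EuclideanSpace ℝ (Fin 4)) M] [IsManifold (𝓡 4) ∞ M],
        (M ≃ₕ 𝕊⁴) → ∀ (k : Fin 3 → ℕ) (T : Fin 3 → Set M),
          IsGKTrisection M 3 k T → DT M T → Nonempty (M ≃ₘ⟮𝓡 4, 𝓡 4⟯ 𝕊⁴) :=
  Iff.rfl

/-- The crux is the rung `g₀ = 3` of the parametrised family (`Iff.rfl`). [folklore] -/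
theorem dependentTripleGenusThreeStandard_iff_at_three :
    DependentTripleGenusThreeStandard ↔ DependentTripleStandardAt 3 :=
  Iff.rfl

/-! ### (a) The shield `S → C`, at every genus -/

/-- **Every rung is implied by the summit**: `SmoothPoincare4 → DependentTripleStandardAt g₀`
for all `g₀` — the conclusion is an instance of SPC4; trisection and triple are unused.
[folklore] -/
theorem dependentTripleStandardAt_of_spc4 (h : _root_.SmoothPoincare4) (g₀ : ℕ) :
    DependentTripleStandardAt g₀ := by
  intro M _ _ _ _ _ e _k _T _hT _hdt
  exact h M ‹_› ‹_› e

/-- **Shield** (`S → C`): the rung `g₀ = 3` of `dependentTripleStandardAt_of_spc4` (the same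
statement is landed as `Theorems.dependentTripleGenusThreeStandard_of_smoothPoincare`,
prover-pitem-18000-0, p156575; re-proved here so that this workfile imports only the route file and
proved Literature modules). [folklore] -/
theorem shield (h : _root_.SmoothPoincare4) : DependentTripleGenusThreeStandard :=
  dependentTripleGenusThreeStandard_iff_at_three.mpr (dependentTripleStandardAt_of_spc4 h 3)

/-! ### (b) Kill criterion -/

/-- A refutation of the crux refutes the summit. [folklore] -/
theorem not_spc4_of_not (h : ¬ DependentTripleGenusThreeStandard) : ¬ _root_.SmoothPoincare4 :=
  fun hs => h (shield hs)

variable {M : Type} [TopologicalSpace M] [ChartedSpace (EuclideanSpace ℝ (Fin 4)) M]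
  [IsManifold (𝓡 4) ∞ M]

/-- A diffeomorphism to the round sphere pulls Gay–Kirby's genus-`0` trisection of `S⁴`
(`sphere_genusZero_gkTrisection_holds`, PROVED) back to a genus-`0` GK-trisection of `M`
(`IsGKTrisection.image_diffeomorph'`, PROVED). [folklore] -/
theorem exists_gkTrisection_genus_zero_of_diffeomorph (Φ : M ≃ₘ⟮𝓡 4, 𝓡 4⟯ 𝕊⁴) :
    ∃ T : Fin 3 → Set M, IsGKTrisection M 0 (fun _ => 0) T := by
  obtain ⟨S₀, hS₀⟩ := sphere_genusZero_gkTrisection_holds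
  exact ⟨fun i => Φ.symm '' S₀ i, hS₀.isGKTrisection.image_diffeomorph' Φ.symm⟩

/-- **What a kill would be**: a smooth homotopy 4-sphere `M` carrying a genus-3 GK-trisection
`T` with a dependent triple (`DT M T`) and admitting NO diffeomorphism to the round `S⁴` — an
exotic 4-sphere of trisection genus at most `3`. [folklore] -/
theorem exotic_of_not (h : ¬ DependentTripleGenusThreeStandard) :
    ∃ (M : Type) (_ : TopologicalSpace M) (_ : T2Space M) (_ : SecondCountableTopology M)
      (_ : ChartedSpace (EuclideanSpace ℝ (Fin 4)) M) (_ : IsManifold (𝓡 4) ∞ M),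
      Nonempty (M ≃ₕ 𝕊⁴) ∧
      (∃ (k : Fin 3 → ℕ) (T : Fin 3 → Set M), IsGKTrisection M 3 k T ∧ DT M T) ∧
      IsEmpty (M ≃ₘ⟮𝓡 4, 𝓡 4⟯ 𝕊⁴) ∧ gkTrisectionGenus M ≤ 3 := by
  rw [dependentTripleGenusThreeStandard_iff] at h
  push Not at h
  obtain ⟨M, _, _, _, _, _, e, k, T, hT, hdt, hE⟩ := h
  exact ⟨M, ‹_›, ‹_›, ‹_›, ‹_›, ‹_›, ⟨e⟩, ⟨k, T, hT, hdt⟩, hE,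
    by exact_mod_cast gkTrisectionGenus_le hT⟩

/-! ### (d) Restates-summit probes -/

/-- **Dropping both geometric hypotheses restates the summit verbatim.** The decl with
`IsGKTrisection M 3 k T` and the dependent triple deleted — "every smooth homotopy 4-sphere over
the bare binders is diffeomorphic to `S⁴`" — is LITERALLY `SmoothPoincare4` (Mathlib's
`ContinuousMap.HomotopyEquiv.NonemptyDiffeomorphSphere M 4`, closed over Hausdorff second-countable
`M : Type`).  So relative to `S` the item's entire content is its geometric hypothesis; the
converse probe `C → S` is not available (the item says nothing about homotopy spheres of
trisection genus `≥ 4`, nor about genus-3 trisections without a dependent triple). [folklore] -/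
theorem withoutGeometry_iff_spc4 :
    (∀ (M : Type) [TopologicalSpace M] [T2Space M] [SecondCountableTopology M]
        [ChartedSpace (EuclideanSpace ℝ (Fin 4)) M] [IsManifold (𝓡 4) ∞ M],
        (M ≃ₕ 𝕊⁴) → Nonempty (M ≃ₘ⟮𝓡 4, 𝓡 4⟯ 𝕊⁴)) ↔ _root_.SmoothPoincare4 := by
  constructor
  · intro h M _ _ _ cs im e
    exact h M e
  · intro h M _ _ _ _ _ e
    exact h M ‹_› ‹_› e

/-- In particular the mutated statement implies the crux (and every rung). [folklore] -/
theorem dependentTripleStandardAt_of_withoutGeometry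
    (h : ∀ (M : Type) [TopologicalSpace M] [T2Space M] [SecondCountableTopology M]
        [ChartedSpace (EuclideanSpace ℝ (Fin 4)) M] [IsManifold (𝓡 4) ∞ M],
        (M ≃ₕ 𝕊⁴) → Nonempty (M ≃ₘ⟮𝓡 4, 𝓡 4⟯ 𝕊⁴)) (g₀ : ℕ) :
    DependentTripleStandardAt g₀ :=
  dependentTripleStandardAt_of_spc4 (withoutGeometry_iff_spc4.mp h) g₀

/-! ### (e) The type of a genus-3 trisection of a homotopy sphere -/

section TypeOfTrisection

variable {N : Type} [TopologicalSpace N] [T2Space N] [SecondCountableTopology N]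
  [ChartedSpace (EuclideanSpace ℝ (Fin 4)) N] [IsManifold (𝓡 4) ∞ N]

/-- `M ≃ₕ S⁴` is compact (proved tree fact, Hatcher Prop. 3.29). [cite: HatcherAT2002, Prop. 3.29 and Cor. 2.11] -/
theorem compactSpace_of_he (e : N ≃ₕ 𝕊⁴) : CompactSpace N :=
  compactSpace_of_homotopyEquiv_sphere_four_holds N e

/-- **Unconditionally `Σ kᵢ = 3`** for a genus-3 GK-trisection of a smooth homotopy 4-sphere
(bare binders): the proved Euler-characteristic identity `g = k₀ + k₁ + k₂`
(`gkTrisection_genus_eq_sum_of_homotopyEquiv_sphere_holds`) with compactness and an orientation of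
`M ≃ₕ S⁴` (both proved in tree). [cite: GayKirby2016, Remark 2] -/
theorem sum_k_eq_three (e : N ≃ₕ 𝕊⁴) {k : Fin 3 → ℕ} {T : Fin 3 → Set N}
    (hT : IsGKTrisection N 3 k T) : k 0 + k 1 + k 2 = 3 := by
  haveI := compactSpace_of_he e
  obtain ⟨o⟩ := isOrientable_of_homotopyEquiv_sphere_four_holds N e
  exact (gkTrisection_genus_eq_sum_of_homotopyEquiv_sphere_holds N o 3 k T hT e).symm

/-- **Type dichotomy = Aranda–Zupan's standing split (p. 6).** Under the decl's hypotheses the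
type is either the balanced `(3;1,1,1)` — the case AZ25 actually treat ("we will henceforth assume
… kᵢ ∈ {0,1}") — or some `kᵢ ≥ 2 = g − 1`, the range of MSZ16 Prop. 2.6 / Thm. 1.2 (reducible,
connected sum of genus-one trisections; `S⁴` for a homotopy sphere — in tree modulo the named fact
`msz_homotopySphere_gk`, see `Theorems.dependentTripleGenusThreeStandard_of_msz_of_balanced`).
[cite: ArandaZupan2025, Prop. 2.6 and the paragraph after it (p. 6)] -/
theorem type_dichotomy (e : N ≃ₕ 𝕊⁴) {k : Fin 3 → ℕ} {T : Fin 3 → Set N}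
    (hT : IsGKTrisection N 3 k T) : (k = fun _ => 1) ∨ ∃ i, 2 ≤ k i := by
  have hs := sum_k_eq_three e hT
  by_cases h : ∃ i, 2 ≤ k i
  · exact Or.inr h
  · push Not at h
    refine Or.inl (funext fun i => ?_)
    have h0 := h 0; have h1 := h 1; have h2 := h 2
    fin_cases i <;> simp <;> omega

end TypeOfTrisection

end Summit.SmoothPoincare4.SmoothPoincare4.Cruxes.DependentTripleGenusThreeStandard.BirthAttack
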